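import Mathlib
import Summits.MatrixMultiplication.MatrixMultiplication.Theses.HiddenToeplitzCorners
import Literature.Computability.AlgebraicComplexity.DeterminantIrreducible

/-!
# `HiddenToeplitzCorners.CostGlue` (stmt-MatrixMultiplication-7498):
# `ToeplitzLikeDetCost → HiddenCorners → CheapIdealMembers`

Route `MatrixMultiplication/HiddenToeplitzCorners`, support item (glue).

Given `ε > 0` put `ε' := min ε 1 / 8`.  `HiddenCorners ε'` gives, frequently in `r`, a pencil
`T(X) = Σ X_ab T_ab` of `N × N` matrices with `N ≤ r^(2+ε')`, split Stein generators of length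
`d ≤ r^ε'` and sparsity `s ≤ r^(2+ε')`, generically nonsingular (`det T(X₀) ≠ 0`) and singular on
every singular `X`; `ToeplitzLikeDetCost ε'` gives, eventually in `r`, for every such pencil with
`N ≤ r³` a nonzero polynomial `Q` with `complexity (Q · det T(X)) ≤ (d²N + s)·r^ε'`.  Frequently ∧
eventually is frequently, so along an unbounded set of `r ≥ 1` with `2 ≤ r^(4ε')` we get both.
Then `f := Q · det T(X)` (the pencil determinant as a polynomial in the `r²` variables) is

* nonzero: `Q ≠ 0`, and evaluating `det T(X)` at `X₀` gives `det T(X₀) ≠ 0` (`RingHom.map_det`);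
* divisible by the generic determinant `det X`: `det T(X)` vanishes on the zero locus of `det X`,
  hence lies in the radical of `(det X)` by Hilbert's Nullstellensatz
  (`MvPolynomial.vanishingIdeal_zeroLocus_eq_radical`), and `(det X)` is a prime ideal
  (`Literature.Computability.AlgebraicComplexity.detPoly_prime`), so `det X ∣ det T(X)`;
* cheap: `(d²N + s)·r^ε' ≤ 2·r^(2+4ε') ≤ r^(2+8ε') ≤ r^(2+ε)`.

No new definitions; tree theorems used: `detPoly_prime` (DeterminantIrreducible.lean).
-/

-- the tree's namespace `Summit.MatrixMultiplication.MatrixMultiplication.…` repeats a component by design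
set_option linter.dupNamespace false

namespace Summit.MatrixMultiplication.MatrixMultiplication.Theorems

open scoped BigOperators
open Filter
open Literature.Computability.AlgebraicComplexity
open Summit.MatrixMultiplication.MatrixMultiplication.Theses.HiddenToeplitzCorners
  (ToeplitzLikeDetCost HiddenCorners CheapIdealMembers CostGlue)

/-! ## Evaluating the pencil determinant -/

/-- Evaluating the determinant of the polynomial pencil `Σ_ab X_ab • T_ab` at a point `x` gives the
determinant of the numerical pencil `Σ_ab x_ab • T_ab`. [folklore] -/
theorem costGlue_eval_pencil_det {r N : ℕ} (T : Fin r → Fin r → Matrix (Fin N) (Fin N) ℂ)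
    (x : Fin r × Fin r → ℂ) :
    MvPolynomial.eval x (∑ a : Fin r, ∑ b : Fin r,
      (MvPolynomial.X (a, b) : MvPolynomial (Fin r × Fin r) ℂ) •
        (T a b).map (MvPolynomial.C : ℂ → MvPolynomial (Fin r × Fin r) ℂ)).det =
      (∑ a : Fin r, ∑ b : Fin r, x (a, b) • T a b).det := by
  rw [RingHom.map_det, RingHom.mapMatrix_apply]
  congr 1
  ext i j
  simp [Matrix.map_apply, Matrix.sum_apply, Matrix.smul_apply]

/-! ## Nullstellensatz: vanishing on singular matrices forces divisibility by `det X` -/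

/-- A polynomial in the `r²` matrix entries (`r ≥ 1`) which vanishes at every singular matrix is
divisible by the generic determinant `det X`: by Hilbert's Nullstellensatz it lies in the radical of
the principal ideal `(det X)`, which is prime (`detPoly_prime`). [folklore] -/
theorem costGlue_det_dvd_of_vanish {r : ℕ} (hr : 0 < r) {p : MvPolynomial (Fin r × Fin r) ℂ}
    (hp : ∀ x : Fin r × Fin r → ℂ, (Matrix.of fun i j : Fin r => x (i, j)).det = 0 →
      MvPolynomial.eval x p = 0) :
    (Matrix.mvPolynomialX (Fin r) (Fin r) ℂ).det ∣ p := by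
  haveI : Nonempty (Fin r) := ⟨⟨0, hr⟩⟩
  have hprime : Prime (Matrix.mvPolynomialX (Fin r) (Fin r) ℂ).det :=
    detPoly_prime (k := ℂ) (n := Fin r)
  have hrad : p ∈ (Ideal.span {(Matrix.mvPolynomialX (Fin r) (Fin r) ℂ).det}).radical := by
    rw [← MvPolynomial.vanishingIdeal_zeroLocus_eq_radical (K := ℂ),
      MvPolynomial.mem_vanishingIdeal_iff]
    intro x hx
    rw [MvPolynomial.zeroLocus_span] at hx
    have hx' : MvPolynomial.aeval x (Matrix.mvPolynomialX (Fin r) (Fin r) ℂ).det = 0 :=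
      hx _ (Set.mem_singleton _)
    rw [MvPolynomial.aeval_eq_eval, Matrix.eval_det_mvPolynomialX] at hx'
    rw [MvPolynomial.aeval_eq_eval]
    exact hp x hx'
  obtain ⟨n, hn⟩ := Ideal.mem_radical_iff.mp hrad
  exact hprime.dvd_of_dvd_pow (Ideal.mem_span_singleton.mp hn)

/-! ## Cost bookkeeping -/

/-- The exponent bookkeeping of `CostGlue`: with `x ≥ 1`, `8ε' ≤ ε`, `2 ≤ x^(4ε')`,
`N ≤ x^(2+ε')`, `0 ≤ d ≤ x^ε'`, `s ≤ x^(2+ε')`, any `c ≤ (d²N + s)·x^ε'` satisfies `c ≤ x^(2+ε)`.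
[folklore] -/
theorem costGlue_cost_arith {x ε ε' N d s c : ℝ} (hx : 1 ≤ x) (h8 : 8 * ε' ≤ ε)
    (h2 : 2 ≤ x ^ (4 * ε')) (hN0 : 0 ≤ N) (hN : N ≤ x ^ (2 + ε')) (hd0 : 0 ≤ d)
    (hd : d ≤ x ^ ε') (hs : s ≤ x ^ (2 + ε')) (hc : c ≤ (d ^ 2 * N + s) * x ^ ε') :
    c ≤ x ^ (2 + ε) := by
  have hx0 : 0 < x := by linarith
  have hε'0 : 0 ≤ ε' := by
    by_contra hneg
    have hneg' : ε' < 0 := not_le.mp hneg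
    have : x ^ (4 * ε') ≤ x ^ (0 : ℝ) := Real.rpow_le_rpow_of_exponent_le hx (by linarith)
    rw [Real.rpow_zero] at this
    linarith
  have hd2 : d ^ 2 ≤ x ^ (2 * ε') := by
    rw [mul_comm, Real.rpow_mul hx0.le, Real.rpow_two]
    exact pow_le_pow_left₀ hd0 hd 2
  have h1 : d ^ 2 * N ≤ x ^ (2 + 3 * ε') := by
    calc d ^ 2 * N ≤ x ^ (2 * ε') * x ^ (2 + ε') :=
          mul_le_mul hd2 hN hN0 (Real.rpow_nonneg hx0.le _)
      _ = x ^ (2 + 3 * ε') := by rw [← Real.rpow_add hx0]; congr 1; ring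
  have h2' : s ≤ x ^ (2 + 3 * ε') :=
    hs.trans (Real.rpow_le_rpow_of_exponent_le hx (by linarith))
  have h3 : (d ^ 2 * N + s) * x ^ ε' ≤ 2 * x ^ (2 + 4 * ε') := by
    have hsum : d ^ 2 * N + s ≤ 2 * x ^ (2 + 3 * ε') := by linarith
    calc (d ^ 2 * N + s) * x ^ ε' ≤ (2 * x ^ (2 + 3 * ε')) * x ^ ε' :=
          mul_le_mul_of_nonneg_right hsum (Real.rpow_nonneg hx0.le _)
      _ = 2 * x ^ (2 + 4 * ε') := by
          rw [mul_assoc, ← Real.rpow_add hx0]; congr 1; congr 1; ring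
  have h4 : 2 * x ^ (2 + 4 * ε') ≤ x ^ (2 + ε) := by
    calc 2 * x ^ (2 + 4 * ε') ≤ x ^ (4 * ε') * x ^ (2 + 4 * ε') :=
          mul_le_mul_of_nonneg_right h2 (Real.rpow_nonneg hx0.le _)
      _ = x ^ (2 + 8 * ε') := by rw [← Real.rpow_add hx0]; congr 1; ring
      _ ≤ x ^ (2 + ε) := Real.rpow_le_rpow_of_exponent_le hx (by linarith)
  linarith

/-! ## The glue -/

/-- **Settles `stmt-MatrixMultiplication-7498`** (`CostGlue`, route `HiddenToeplitzCorners`):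
`ToeplitzLikeDetCost → HiddenCorners → CheapIdealMembers`.  With `ε' = min ε 1 / 8`, a
hidden-corner pencil at `(r, ε')` past the `ToeplitzLikeDetCost` threshold yields
`f := Q · det T(X)`, nonzero (evaluation at `X₀`), divisible by `det X` (Nullstellensatz for the
prime ideal `(det X)`, `costGlue_det_dvd_of_vanish`) and of complexity
`≤ (d²N + s)·r^ε' ≤ r^(2+ε)` (`costGlue_cost_arith`). [folklore] -/
theorem costGlue_proof :
    Summit.MatrixMultiplication.MatrixMultiplication.Theses.HiddenToeplitzCorners.CostGlue := by
  unfold Summit.MatrixMultiplication.MatrixMultiplication.Theses.HiddenToeplitzCorners.CostGlue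
  intro hT hH ε hε
  -- the auxiliary exponent
  set ε' : ℝ := min ε 1 / 8 with hε'
  have hε'pos : 0 < ε' := by
    have : 0 < min ε 1 := lt_min hε one_pos
    rw [hε']; linarith
  have h8 : 8 * ε' ≤ ε := by
    have : min ε 1 ≤ ε := min_le_left _ _
    rw [hε']; linarith
  have hε'1 : ε' ≤ 1 := by
    have : min ε 1 ≤ 1 := min_le_right _ _
    rw [hε']; linarith
  have hHC := hH ε' hε'pos
  have hDC := hT ε' hε'pos
  have hr1 : ∀ᶠ r : ℕ in atTop, 1 ≤ r := eventually_ge_atTop 1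
  have hr2 : ∀ᶠ r : ℕ in atTop, (2 : ℝ) ≤ (r : ℝ) ^ (4 * ε') :=
    ((tendsto_rpow_atTop (by linarith : 0 < 4 * ε')).comp
      tendsto_natCast_atTop_atTop).eventually_ge_atTop 2
  refine (hHC.and_eventually (hDC.and (hr1.and hr2))).mono ?_
  rintro r ⟨⟨N, d, hN, hd, T, G₀, H₀, G₁, H₁, hStein, hs, ⟨X₀, hX₀⟩, hsing⟩, hD, hr1, hr2⟩
  have hr1' : (1 : ℝ) ≤ (r : ℝ) := by exact_mod_cast hr1
  -- `N ≤ r³` (as naturals), to feed `ToeplitzLikeDetCost`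
  have hNr3 : N ≤ r ^ 3 := by
    have h3 : (N : ℝ) ≤ (r : ℝ) ^ (3 : ℝ) :=
      hN.trans (Real.rpow_le_rpow_of_exponent_le hr1' (by linarith))
    have h3' : (N : ℝ) ≤ ((r ^ 3 : ℕ) : ℝ) := by
      rw [Nat.cast_pow, ← Real.rpow_natCast]
      exact_mod_cast h3
    exact_mod_cast h3'
  obtain ⟨Q, hQ, hcost⟩ := hD N d hNr3 T G₀ H₀ G₁ H₁ hStein
  -- the pencil determinant as a polynomial, and its two algebraic properties
  have hdetP_ne : (∑ a : Fin r, ∑ b : Fin r,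
      (MvPolynomial.X (a, b) : MvPolynomial (Fin r × Fin r) ℂ) •
        (T a b).map (MvPolynomial.C : ℂ → MvPolynomial (Fin r × Fin r) ℂ)).det ≠ 0 := by
    intro h
    apply hX₀
    have key := costGlue_eval_pencil_det T (fun p => X₀ p.1 p.2)
    rw [h, map_zero] at key
    exact key.symm
  have hdetP_dvd : (Matrix.mvPolynomialX (Fin r) (Fin r) ℂ).det ∣ (∑ a : Fin r, ∑ b : Fin r,
      (MvPolynomial.X (a, b) : MvPolynomial (Fin r × Fin r) ℂ) •
        (T a b).map (MvPolynomial.C : ℂ → MvPolynomial (Fin r × Fin r) ℂ)).det := by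
    refine costGlue_det_dvd_of_vanish hr1 fun x hx => ?_
    rw [costGlue_eval_pencil_det]
    have := hsing (Matrix.of fun i j : Fin r => x (i, j)) hx
    simpa only [Matrix.of_apply] using this
  refine ⟨Q * (∑ a : Fin r, ∑ b : Fin r,
      (MvPolynomial.X (a, b) : MvPolynomial (Fin r × Fin r) ℂ) •
        (T a b).map (MvPolynomial.C : ℂ → MvPolynomial (Fin r × Fin r) ℂ)).det,
    mul_ne_zero hQ hdetP_ne, dvd_mul_of_dvd_right hdetP_dvd Q, ?_⟩
  -- cost bookkeeping
  exact costGlue_cost_arith hr1' h8 hr2 (Nat.cast_nonneg N) hN (Nat.cast_nonneg d) hd hs hcost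

end Summit.MatrixMultiplication.MatrixMultiplication.Theorems
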